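import Literature.LinearAlgebra.Matrix.UnitaryGroupWeylGroup      -- ★ `Literature.LinearAlgebra.Matrix.monomial` (monomial matrices, conjugation of diagonals)
import Literature.NumberTheory.Automorphic.ArchDiagonalTorus       -- ★ D1′b: `circleDiagonal`, `circleDiagonal_mem_unitaryGroupOfForm_diagonal`
import HarnessLib

/-!
# The Weyl action on the circle torus of `U(diag e)(ℂ)`: permutation and weighted-monomial conjugators, stable conjugacy of `diag z` and `diag (z ∘ σ⁻¹)`
# (road D2′ gap (V8), the conjugacy-class bookkeeping of a regular stable class; Rogawski 1990 §3.1, §8.2 p. 122; Bröcker–tom Dieck IV (3.2))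

Topic `NumberTheory/Automorphic`; namespace `Literature.NumberTheory.Automorphic.UnitaryGroup`.  THEOREMS ONLY (no `def`, no instance, no notation, no axiom, no `sorry`).
Cell `pub/hodgecm-mathlib`, ENGINE T1 (crux H413 = `stmt-HodgeConjecture-24833`); floor-1 preparation, count-neutral, under books rows #88 (ST-∞) ∕ #111 (S-d) (F0P3a-p02 (g8)'s
CENSUS-D2prime-HClimit §4 gap (V8) «three classes in a regular stable class of `U(2,1)`» — this file is the EASY direction: which relabellings of the torus ARE realised
by conjugation); author F0P3a-p06 (g9), over ★ `Literature.LinearAlgebra.Matrix.UnitaryGroupWeylGroup` (`monomial σ c`, its products, `det`, conjugate transpose —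
Bröcker–tom Dieck IV (3.2) «the Weyl group of `U(n)` is `S(n)`») and ★ D1′b `circleDiagonal`.

WHAT IS PROVED (`G = U(diag e)(ℂ) = unitaryGroupOfForm (starRingEnd ℂ) (diagonal e)`, e.g. `e = σ_w ∘ α` = ★ `archLocal L N (diagonal α) w` up to `Matrix.diagonal_map`):
* `monomial_conj_circleDiagonal` ∕ `monomial_conj_circleDiagonal_of_ne_zero`: `M(σ, c) · diag(z) · M(σ, c)⁻¹ = diag(z ∘ σ⁻¹)` in `GL_N(ℂ)` (`c = 1` resp. any invertible
  weights); `charpoly_circleDiagonal_comp_perm`: hence `diag z` and `diag (z ∘ σ⁻¹)` have the SAME characteristic polynomial — STABLY CONJUGATE — for EVERY `σ`.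
* **`monomial_one_mem_unitaryGroupOfForm_diagonal_iff`**: `M(σ, 1) ∈ U(diag e)(ℂ) ↔ e ∘ σ = e`; **`exists_conj_circleDiagonal_eq_of_comp_perm_eq`**: so for form-preserving
  `σ`, `diag z ∼ diag (z ∘ σ⁻¹)` INSIDE `G`.
* **`exists_conj_circleDiagonal_eq_of_sign`** (REAL `e`, `e_j ∕ e_{σ j} > 0` for all `j`): the weighted monomial `M(σ, c)`, `c_j = √(e_j ∕ e_{σ j})`, lies in `U(diag e)(ℂ)` and conjugates
  `diag z` to `diag (z ∘ σ⁻¹)` — SIGN-PATTERN-PRESERVING PERMUTATIONS ARE IN THE WEYL GROUP OF `U(p, q)` w.r.t. the compact diagonal Cartan.  For `U(2,1)`, `e = (+, −, +)`: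
  the transposition of `e₁, e₃` is realised, so the `S₃`-orbit of a regular `diag z` (one stable class, six torus points) meets at most `|S₃ ∕ (S₂ × S₁)| = 3` classes —
  Rogawski's `γ, γ₁, γ₂` (§8.2 p. 122).  The converse («exactly 3»: a non-sign-preserving relabelling is NOT conjugate in `G`) is NOT proved here.
HONEST LABEL: HC_CM is proved only modulo the printed citations until rung 0 closes; this file pays nothing by itself.

## References
* [Rogawski1990] J. D. Rogawski, *Automorphic Representations of Unitary Groups in Three Variables*, Ann. of Math. Stud. 123 (1990): §3.1 p. 19 (stable conjugacy = same
  characteristic polynomial for `U(3)`), §8.2 p. 122 (the three classes `γ, γ₁, γ₂` in a regular stable class of the compact Cartan of `U(2,1)`).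
* [BrockerTomDieck1985] Th. Bröcker, T. tom Dieck, *Representations of Compact Lie Groups*, GTM 98 (1985), IV (3.2)–(3.3) (monomial matrices; `W(U(n)) = S(n)`).
-/

set_option autoImplicit false

noncomputable section

open Matrix Equiv NumberField NumberField.InfinitePlace
open Literature.LinearAlgebra.Matrix
open scoped MatrixGroups ComplexConjugate

namespace Literature.NumberTheory.Automorphic.UnitaryGroup

section Weyl

variable (N : ℕ)

/-- The permutation matrix `M(σ, 1)` (★ `monomial σ 1`) as an element of `GL_N(ℂ)` (`det = sign σ ≠ 0`). [cite: BrockerTomDieck1985, IV (3.2) (p0161)] -/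
theorem det_monomial_one_ne_zero (σ : Perm (Fin N)) : (monomial σ (fun _ => (1 : ℂ))).det ≠ 0 := by
  rw [det_monomial]
  simp

/-- **The permutation matrix conjugates the circle torus by the permutation**: `M(σ,1) · diag(z) · M(σ,1)⁻¹ = diag(z ∘ σ⁻¹)` in `GL_N(ℂ)` — every relabelling of the
torus coordinates is realised by conjugation in `GL_N(ℂ)`, so `diag z` and `diag (z ∘ σ⁻¹)` are STABLY conjugate (same characteristic polynomial) for EVERY `σ`.
[cite: BrockerTomDieck1985, IV §3 (p0161)] [cite: Rogawski1990, §3.1 p. 19; §8.2 p. 122] -/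
theorem monomial_conj_circleDiagonal (σ : Perm (Fin N)) (z : Fin N → Circle) :
    Matrix.GeneralLinearGroup.mkOfDetNeZero _ (det_monomial_one_ne_zero N σ) * circleDiagonal N z *
        (Matrix.GeneralLinearGroup.mkOfDetNeZero _ (det_monomial_one_ne_zero N σ))⁻¹ =
      circleDiagonal N (fun i => z (σ.symm i)) := by
  rw [mul_inv_eq_iff_eq_mul]
  apply Units.ext
  simp only [Units.val_mul, coe_circleDiagonal, Matrix.GeneralLinearGroup.val_mkOfDetNeZero]
  rw [monomial_mul_diagonal, diagonal_mul_monomial]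
  congr 1
  funext j
  rw [Equiv.symm_apply_apply, mul_one, one_mul]

/-- `diag z` and `diag (z ∘ σ⁻¹)` have the same characteristic polynomial (any `σ`). [cite: Rogawski1990, §3.1 p. 19] -/
theorem charpoly_circleDiagonal_comp_perm (σ : Perm (Fin N)) (z : Fin N → Circle) :
    ((circleDiagonal N (fun i => z (σ.symm i)) : GL (Fin N) ℂ) : Matrix (Fin N) (Fin N) ℂ).charpoly =
      ((circleDiagonal N z : GL (Fin N) ℂ) : Matrix (Fin N) (Fin N) ℂ).charpoly := by
  have h := Matrix.charpoly_units_conj (Matrix.GeneralLinearGroup.mkOfDetNeZero _ (det_monomial_one_ne_zero N σ))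
    ((circleDiagonal N z : GL (Fin N) ℂ) : Matrix (Fin N) (Fin N) ℂ)
  rw [← monomial_conj_circleDiagonal N σ z, Units.val_mul, Units.val_mul, Matrix.coe_units_inv]
  exact h

/-- `M(σ, c) · diag(z) · M(σ, c)⁻¹ = diag(z ∘ σ⁻¹)` for ANY invertible weights `c` (the diagonal part of `M(σ, c)` commutes with `diag z`).
[cite: BrockerTomDieck1985, IV §3 (p0161)] -/
theorem monomial_conj_circleDiagonal_of_ne_zero (σ : Perm (Fin N)) {c : Fin N → ℂ} (hc : (monomial σ c).det ≠ 0) (z : Fin N → Circle) :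
    Matrix.GeneralLinearGroup.mkOfDetNeZero _ hc * circleDiagonal N z * (Matrix.GeneralLinearGroup.mkOfDetNeZero _ hc)⁻¹ =
      circleDiagonal N (fun i => z (σ.symm i)) := by
  rw [mul_inv_eq_iff_eq_mul]
  apply Units.ext
  simp only [Units.val_mul, coe_circleDiagonal, Matrix.GeneralLinearGroup.val_mkOfDetNeZero]
  rw [monomial_mul_diagonal, diagonal_mul_monomial]
  congr 1
  funext j
  rw [Equiv.symm_apply_apply, mul_comm]

/-- **A permutation FIXING the diagonal form lies in its unitary group**: `M(σ, 1) ∈ U(diag e)(ℂ)` iff `e ∘ σ = e` (`M(σ,1)ᴴ diag(e) M(σ,1) = diag(e ∘ σ)`, ★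
`conjTranspose_mul_diagonal_mul_monomial`).  For `e = σ_w ∘ α` this is the part of the Weyl group of `U(σ_w diag α)(ℂ)` realised by honest permutation matrices.
[cite: BrockerTomDieck1985, IV (3.2) (p0161)] [cite: Rogawski1990, §3.1 p. 19] -/
theorem monomial_one_mem_unitaryGroupOfForm_diagonal_iff (σ : Perm (Fin N)) (e : Fin N → ℂ) :
    Matrix.GeneralLinearGroup.mkOfDetNeZero _ (det_monomial_one_ne_zero N σ) ∈ unitaryGroupOfForm (starRingEnd ℂ) (Matrix.diagonal e) ↔
      e ∘ σ = e := by
  rw [mem_unitaryGroupOfForm_iff, Matrix.GeneralLinearGroup.val_mkOfDetNeZero]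
  have h : ((monomial σ fun _ : Fin N => (1 : ℂ)).map (starRingEnd ℂ))ᵀ = (monomial σ fun _ : Fin N => (1 : ℂ))ᴴ := rfl
  rw [h, conjTranspose_mul_diagonal_mul_monomial (fun _ => by simp) e]
  exact ⟨fun hd => funext fun i => congrFun (Matrix.diagonal_injective hd) i, fun hσ => by
    exact congrArg Matrix.diagonal (funext fun i => congrFun hσ i)⟩

/-- **CONJUGACY INSIDE `U(diag e)(ℂ)` under a form-preserving permutation**: if `e ∘ σ = e` then `diag z` and `diag (z ∘ σ⁻¹)` are conjugate IN the unitary group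
(by the permutation matrix).  With `e = σ_w ∘ α`: relabelling the torus coordinates by a symmetry of `α` does not change the conjugacy class in `G_w`.
[cite: BrockerTomDieck1985, IV (3.2) (p0161)] [cite: Rogawski1990, §8.2 p. 122] -/
theorem exists_conj_circleDiagonal_eq_of_comp_perm_eq {σ : Perm (Fin N)} {e : Fin N → ℂ} (hσ : e ∘ σ = e) (z : Fin N → Circle) :
    ∃ g : unitaryGroupOfForm (starRingEnd ℂ) (Matrix.diagonal e),
      (g : GL (Fin N) ℂ) * circleDiagonal N z * (g : GL (Fin N) ℂ)⁻¹ = circleDiagonal N (fun i => z (σ.symm i)) :=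
  ⟨⟨_, (monomial_one_mem_unitaryGroupOfForm_diagonal_iff N σ e).mpr hσ⟩, monomial_conj_circleDiagonal N σ z⟩

/-- `det M(σ, c) ≠ 0` for weights with no zero. [cite: BrockerTomDieck1985, IV (3.2) (p0161)] -/
theorem det_monomial_ne_zero (σ : Perm (Fin N)) {c : Fin N → ℂ} (hc : ∀ j, c j ≠ 0) : (monomial σ c).det ≠ 0 := by
  rw [det_monomial]
  exact mul_ne_zero (by simp) (Finset.prod_ne_zero_iff.mpr fun j _ => hc j)

/-- **SIGN-PATTERN-PRESERVING PERMUTATIONS ARE IN THE WEYL GROUP OF `U(p, q)`**: for a REAL diagonal form `diag(e)` (`e_j ≠ 0`) and a permutation `σ` with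
`e_j ∕ e_{σ j} > 0` for all `j`, the weighted monomial matrix `M(σ, c)`, `c_j = √(e_j ∕ e_{σ j})`, lies in `U(diag e)(ℂ)` (`M ᴴ diag(e) M = diag(c_j² e_{σ j}) = diag e`)
and conjugates `diag z` to `diag (z ∘ σ⁻¹)`.  In `U(2,1)` with `e = (+,−,+)` this realises the transposition of `e₁, e₃` — the two-element Weyl group `S₂ × S₁` of the
compact Cartan, whence Rogawski's THREE classes `3 = |S₃ ∕ (S₂ × S₁)|` in a regular stable class (the converse count is not proved here).
[cite: Rogawski1990, §8.2 p. 122; §3.1 p. 19] [cite: BrockerTomDieck1985, IV (3.2) (p0161)] -/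
theorem exists_conj_circleDiagonal_eq_of_sign {σ : Perm (Fin N)} {e : Fin N → ℝ} (hpos : ∀ j, 0 < e j / e (σ j)) (z : Fin N → Circle) :
    ∃ g : unitaryGroupOfForm (starRingEnd ℂ) (Matrix.diagonal fun j => (e j : ℂ)),
      (g : GL (Fin N) ℂ) * circleDiagonal N z * (g : GL (Fin N) ℂ)⁻¹ = circleDiagonal N (fun i => z (σ.symm i)) := by
  -- the weights `c_j = √(e_j ∕ e_{σ j})`, real and positive
  set c : Fin N → ℂ := fun j => ((Real.sqrt (e j / e (σ j)) : ℝ) : ℂ) with hc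
  have hcne : ∀ j, c j ≠ 0 := fun j => by
    simp only [hc, ne_eq, Complex.ofReal_eq_zero]
    exact (Real.sqrt_pos.mpr (hpos j)).ne'
  have hdet := det_monomial_ne_zero N σ hcne
  refine ⟨⟨Matrix.GeneralLinearGroup.mkOfDetNeZero _ hdet, ?_⟩, monomial_conj_circleDiagonal_of_ne_zero N σ hdet z⟩
  rw [mem_unitaryGroupOfForm_iff, Matrix.GeneralLinearGroup.val_mkOfDetNeZero]
  have h : ((monomial σ c).map (starRingEnd ℂ))ᵀ = (monomial σ c)ᴴ := rfl
  rw [h, conjTranspose_monomial, monomial_mul_diagonal, monomial_mul_monomial, inv_mul_cancel, monomial_one]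
  congr 1
  funext j
  -- `conj(c_{σ⁻¹(σ j)}) · e_{σ j} · c_j = e_j`
  rw [Equiv.Perm.inv_def, Equiv.symm_apply_apply]
  have hreal : star (c j) = c j := by simp [hc, Complex.conj_ofReal]
  rw [hreal, hc]
  have hσj : e (σ j) ≠ 0 := fun h0 => by have := hpos j; rw [h0, div_zero] at this; exact lt_irrefl _ this
  have hsq : Real.sqrt (e j / e (σ j)) * Real.sqrt (e j / e (σ j)) = e j / e (σ j) := Real.mul_self_sqrt (hpos j).le
  have : ((Real.sqrt (e j / e (σ j)) : ℝ) : ℂ) * (e (σ j) : ℂ) * ((Real.sqrt (e j / e (σ j)) : ℝ) : ℂ) = (e j : ℂ) := by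
    rw [mul_right_comm, ← Complex.ofReal_mul, hsq]
    have hσj' : (e (σ j) : ℂ) ≠ 0 := Complex.ofReal_ne_zero.mpr hσj
    push_cast
    rw [div_mul_cancel₀ _ hσj']
  simpa using this

end Weyl

end Literature.NumberTheory.Automorphic.UnitaryGroup
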